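import Literature.AlgebraicGeometry.Frobenioids.DivisorMonoidTransport
import Literature.AlgebraicGeometry.Frobenioids.PerfFactorialOrderIsoWeak
import HarnessLib

/-!
# [FrdI] Thm. 4.9: the divisor transport `Φ₁(A) → Φ₂(ΨA)` upgraded to an isomorphism of monoids from the
# ray isomorphisms of Thm. 4.2 (iii) — for WEAKLY perf-factorial `Φ_i` (weak twin of
# `DivisorMonoidTransport.lean`)

Mochizuki, *The geometry of Frobenioids I: the general theory*, Kyushu J. Math. **62** (2008)
293–400, §4, Theorem 4.9 (Category-theoreticity of divisor monoids), proof p. 89 ll. 6–36 (kurims)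
[cite: MochizukiFrdI2008, Thm. 4.9 p.88].

PROOF-ONLY weak twin of `PreFrobenioid.exists_mulEquiv_div_map` (`DivisorMonoidTransport.lean`, seat
abc-iut-w4-d099 lineage): the SAME statement with "`Φ_i` perf-factorial" (Def. 2.4 (i) (a)–(d) as printed)
REPLACED by the named weakening `IsPerfFactorialWeak` of `PerfFactorialWeak.lean` ((a)–(c) verbatim +
(d_ord), (d_res); cell finding F-L2d2-1: (d) fails for the divisor monoids of the tempered Frobenioids of
[EtTh] §3–§5, where [EtTh] Cor. 3.8 (iii) p. 81 and Prop. 5.3 p. 99 invoke the `Ψ^Φ` of [FrdI] Thm. 4.9).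
The hypothesis-free half of the strong file (`div_map_eq_of_div_eq`, `exists_divTransport`: the bijective,
order-preserving divisor transport `T_A`, Def. 1.3 (iii)(d)) is consumed BY NAME; the upgrade to a monoid
isomorphism is the strong proof verbatim over `IsPerfFactorialWeak.map_mul_of_dvd_iff_of_rays`
(`PerfFactorialOrderIsoWeak.lean`). (d) itself is never used; the printed (strong) case is recovered through
`IsPerfFactorial.weak`. Cell abc-iut, layer L1, seat abc-iut-L1-t11 (bottom tranche «T49-WEAK-BASE» of the
[FrdI] Thm. 4.9 / Cor. 4.11 (iii)(iv) weak programme held by seat abc-iut-L1-t14). No new definitions;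
nothing printed is restated as if corrected; nothing here bears on [IUTchIII] Cor. 3.12.

* `PreFrobenioid.exists_mulEquiv_div_map_weak` — for Frobenioids of perfect and isotropic type with
  WEAKLY perf-factorial `Φ_i` and `Ψ`, `Ψ⁻¹` preserving pre-steps, ray isomorphisms computing `Div ∘ Ψ`
  upgrade the divisor transport to `Φ₁(A) ≃* Φ₂(ΨA)` with `T_A (Div φ) = Div (Ψφ)` on all pre-steps out
  of `A`.
-/

namespace Literature.AlgebraicGeometry.Frobenioids

open CategoryTheory Opposite

universe w v v' u u'

namespace PreFrobenioid

variable {D₁ : Type u} [Category.{v} D₁] {Φ₁ : D₁ᵒᵖ ⥤ CommMonCat.{w}} {C₁ : Type u'} [Category.{v'} C₁]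
  {D₂ : Type u} [Category.{v} D₂] {Φ₂ : D₂ᵒᵖ ⥤ CommMonCat.{w}} {C₂ : Type u'} [Category.{v'} C₂]
  {F₁ : C₁ ⥤ ElemFrobenioid Φ₁} {F₂ : C₂ ⥤ ElemFrobenioid Φ₂}

/-- **`Ψ^Φ(A)` at an object with ray isomorphisms** (p. 89 ll. 10–33, per-object half): for Frobenioids
of perfect and isotropic type with `Φ_i` WEAKLY perf-factorial and `Ψ` as above, if on every prime ray
`Φ₁(A)_𝔭` there is an isomorphism of monoids onto some ray `Φ₂(ΨA)_𝔭'` computing `Div ∘ Ψ` on the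
co-angular pre-steps out of `A` (Thm. 4.2 (iii), right-hand isomorphisms), then the divisor transport is
an isomorphism of monoids `Φ₁(A) ≃* Φ₂(ΨA)` computing `Div ∘ Ψ` on all pre-steps out of `A`.
[cite: MochizukiFrdI2008, Thm. 4.9 p.89] -/
theorem exists_mulEquiv_div_map_weak (Ψ : C₁ ≌ C₂) (hF₁ : IsFrobenioid F₁) (hF₂ : IsFrobenioid F₂)
    (hperf₁ : IsOfPerfectType F₁) (hperf₂ : IsOfPerfectType F₂)
    (histr₁ : IsOfIsotropicType F₁) (histr₂ : IsOfIsotropicType F₂)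
    (hpf₁ : Objectwise (fun M _ => IsPerfFactorialWeak M) Φ₁)
    (hpf₂ : Objectwise (fun M _ => IsPerfFactorialWeak M) Φ₂)
    (hpre : ∀ ⦃X Y : C₁⦄ (φ : X ⟶ Y), IsPreStep F₁ φ → IsPreStep F₂ (Ψ.functor.map φ))
    (hpre' : ∀ ⦃X Y : C₂⦄ (φ : X ⟶ Y), IsPreStep F₂ φ → IsPreStep F₁ (Ψ.inverse.map φ)) (A : C₁)
    (hrays : ∀ 𝔭 : Primes (Φ₁.obj (op (baseObj F₁ A))),
      ∃ (𝔭' : Primes (Φ₂.obj (op (baseObj F₂ (Ψ.functor.obj A)))))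
        (r : 𝔭.submonoid ≃* 𝔭'.submonoid),
        ∀ ⦃B : C₁⦄ (φ : A ⟶ B), IsCoAngularPreStep F₁ φ → ∀ h : Div F₁ φ ∈ 𝔭.submonoid,
          (r ⟨Div F₁ φ, h⟩ : Φ₂.obj (op (baseObj F₂ (Ψ.functor.obj A)))) = Div F₂ (Ψ.functor.map φ)) :
    ∃ m : Φ₁.obj (op (baseObj F₁ A)) ≃* Φ₂.obj (op (baseObj F₂ (Ψ.functor.obj A))),
      ∀ ⦃B : C₁⦄ (φ : A ⟶ B), IsPreStep F₁ φ → m (Div F₁ φ) = Div F₂ (Ψ.functor.map φ) := by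
  have hco₁ : ∀ {X Y : C₁} (f : X ⟶ Y), IsCoAngular F₁ f :=
    fun f => isCoAngular_of_isIsotropic_codomains F₁ f fun Z _ => histr₁ Z
  obtain ⟨T, hTb, hTd, hT⟩ := exists_divTransport Ψ hF₁ hF₂ histr₁ histr₂ hpre hpre' A
  have hM : IsPerfFactorialWeak (Φ₁.obj (op (baseObj F₁ A))) := hpf₁ _
  have hN : IsPerfFactorialWeak (Φ₂.obj (op (baseObj F₂ (Ψ.functor.obj A)))) := hpf₂ _
  have hMp := isPerfect_divisorMonoid hF₁ hperf₁ A
  have hNp := isPerfect_divisorMonoid hF₂ hperf₂ (Ψ.functor.obj A)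
  -- `T` is multiplicative on every ray, by the ray isomorphisms
  have hray : ∀ x y : Φ₁.obj (op (baseObj F₁ A)), IsPrimary x → IsPrimary y → x ≼ y →
      T (x * y) = T x * T y := by
    intro x y hx hy hxy
    let 𝔭 : Primes (Φ₁.obj (op (baseObj F₁ A))) := Quotient.mk (primarySetoid _) ⟨y, hy⟩
    have hyp : y ∈ 𝔭.carrier := mem_carrier_mk_of_isPrimary hy
    have hym : y ∈ 𝔭.submonoid := Submonoid.subset_closure hyp
    have hxm : x ∈ 𝔭.submonoid := Submonoid.subset_closure (𝔭.mem_carrier_of_precsim hyp hx.1 hxy)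
    have hxym : x * y ∈ 𝔭.submonoid := mul_mem hxm hym
    obtain ⟨𝔭', r, hr⟩ := hrays 𝔭
    -- realise `x`, `y`, `x y` as zero divisors of co-angular pre-steps out of `A`
    have hTr : ∀ (z : Φ₁.obj (op (baseObj F₁ A))) (hz : z ∈ 𝔭.submonoid),
        T z = (r ⟨z, hz⟩ : Φ₂.obj (op (baseObj F₂ (Ψ.functor.obj A)))) := by
      intro z hz
      obtain ⟨B, φ, hφ, hφz⟩ := hF₁.iii_d_under_surj A z
      subst hφz
      rw [hT φ hφ.2, hr φ hφ hz]
    rw [hTr _ hxym, hTr _ hxm, hTr _ hym, ← Submonoid.coe_mul, ← map_mul]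
    rfl
  have hmul := IsPerfFactorialWeak.map_mul_of_dvd_iff_of_rays hM hN hMp hNp T hTb hTd hray
  have h1 : T 1 = 1 := map_one_of_dvd_iff hN.isDivisorial.isSharp T hTb.2 hTd
  let Tm : Φ₁.obj (op (baseObj F₁ A)) →* Φ₂.obj (op (baseObj F₂ (Ψ.functor.obj A))) :=
    { toFun := T, map_one' := h1, map_mul' := hmul }
  exact ⟨MulEquiv.ofBijective Tm hTb, fun B φ hφ => hT φ hφ⟩

end PreFrobenioid

end Literature.AlgebraicGeometry.Frobenioids
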